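import Literature.NumberTheory.EllipticCurves.PAdicDistributionDensity
import Literature.NumberTheory.EllipticCurves.PAdicDistributionSuccRestrict
import Literature.NumberTheory.EllipticCurves.ProfiniteGroupDistributionComap
import Literature.NumberTheory.EllipticCurves.PAdicOneVariableDilation
import HarnessLib

/-!
# Bounded distributions whose level data are a SUM (resp. ZERO): integrals, densities, `(·)|_{ℤ_p^×}`,
# pull-backs `comap` and inverse Amice transforms are additive in the level data

Topic `NumberTheory/EllipticCurves`; namespace `Literature.NumberTheory.EllipticCurves`.

De Shalit, *Iwasawa theory of elliptic curves with complex multiplication* (1987), I.3.4 Lemma (i) (p. 18):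
"`μ_{ββ'} = μ_β + μ_{β'}`" — the additivity of `β ↦ μ_β`, which makes `i : 𝒰 → Λ(𝒢)`, `i(β) = μ_β`, a
homomorphism (I.3.4 Corollary, II.4.6).  In the tree the measure of `β` is assembled from its power series
`H_β` by FOUR constructions — `invAmice₁` (`H ↦ D_H`, I.3.3 (8)), `BoundedDistribution.density` (`x⁻¹ ·`,
I.3.5 (11)), `restrictUnits` (`|_{ℤ_p^×}`, I.3.3 (7′)) and `GroupDistribution.comap` (pull-back to the Galois
group along `κ`, I.3.3 (9)) — none of which is packaged as an additive map (the tree's distributions carry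
their bound and have no `Add` structure).  This file records, once, that each construction takes level
data that are the SUM of two others (resp. ZERO) to level data that are the sum (resp. zero):

* `BoundedDistribution.integral_eq_add_of_μ_eq_add` / `integral_eq_zero_of_μ_eq_zero` (Riemann sums add);
* `BoundedDistribution.density_μ_eq_add_of_μ_eq_add` / `density_μ_eq_zero_of_μ_eq_zero`;
* `restrictUnits_μ_eq_add_of_μ_eq_add` / `restrictUnits_μ_eq_zero_of_μ_eq_zero`;
* `GroupDistribution.comap_μ_eq_add_of_μ_eq_add` / `comap_μ_eq_zero_of_μ_eq_zero`;
* `invAmice₁_μ_eq_add_of_eq_add` / `invAmice₁_μ_eq_zero_of_eq_zero` (`D_P` for `P = P₁ + P₂`, `P = 0`, any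
  bound proofs; from `invAmice₁_add_μ`).

Companion of `PAdicOneVariableUnitsSocket.lean` §1 (`integral_eq_mul_of_μ_eq_mul`, the multiplicative
twin).  Everything is proved; no named facts, no definitions, no instances, no `sorry`.

## References

* [deShalit1987] E. de Shalit, *Iwasawa theory of elliptic curves with complex multiplication* (1987),
  I.3.4 Lemma (i) (p. 18), I.3.3 (7′)–(9), I.3.5 (11) (p. 17–18).
* [MazurTateTeitelbaum1986Invent] B. Mazur, J. Tate, J. Teitelbaum, Invent. Math. 84 (1986), §I.11.
-/

noncomputable section

open Filter
open scoped Topology Classical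

namespace Literature.NumberTheory.EllipticCurves

/-! ### §1. Integrals, densities, restriction to the units, pull-back -/

namespace BoundedDistribution

variable {X : Type*} [PseudoMetricSpace X] {T : ProfiniteTower X}
variable {𝕜 : Type*} [NormedField 𝕜]

/-- A distribution with vanishing level data has vanishing integrals. [cite: MazurTateTeitelbaum1986Invent, §I.11] -/
theorem integral_eq_zero_of_μ_eq_zero (D : BoundedDistribution T 𝕜) (h : ∀ n a, D.μ n a = 0)
    (f : X → 𝕜) : D.integral f = 0 := by
  have hRS : D.riemannSum f = fun _ ↦ 0 := funext fun n ↦ by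
    rw [riemannSum_def]
    exact Finset.sum_eq_zero fun a _ ↦ by rw [h, zero_mul]
  rw [integral, hRS]
  exact tendsto_const_nhds.limUnder_eq

variable [IsUltrametricDist 𝕜] [CompleteSpace 𝕜]

/-- **If the level data of `D` are the sums of those of `D₁` and `D₂`, then `∫ f dD = ∫ f dD₁ + ∫ f dD₂`**
(`f` uniformly continuous). [cite: MazurTateTeitelbaum1986Invent, §I.11] [cite: deShalit1987, I.3.4 Lemma (i) (p. 18)] -/
theorem integral_eq_add_of_μ_eq_add (D D₁ D₂ : BoundedDistribution T 𝕜)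
    (h : ∀ n a, D.μ n a = D₁.μ n a + D₂.μ n a) {f : X → 𝕜} (hf : UniformContinuous f) :
    D.integral f = D₁.integral f + D₂.integral f := by
  have hRS : D.riemannSum f = fun n ↦ D₁.riemannSum f n + D₂.riemannSum f n := funext fun n ↦ by
    rw [riemannSum_def, riemannSum_def, riemannSum_def, ← Finset.sum_add_distrib]
    exact Finset.sum_congr rfl fun a _ ↦ by rw [h, add_mul]
  have h1 : Tendsto (D.riemannSum f) atTop (𝓝 (D₁.integral f + D₂.integral f)) := by
    rw [hRS]; exact (D₁.tendsto_riemannSum_integral hf).add (D₂.tendsto_riemannSum_integral hf)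
  exact tendsto_nhds_unique (D.tendsto_riemannSum_integral hf) h1

/-- The distribution with density `g` of a levelwise sum is the levelwise sum of the densities.
[cite: deShalit1987, I.3.4 Lemma (i), I.3.5 (11) (p. 18)] -/
theorem density_μ_eq_add_of_μ_eq_add (D D₁ D₂ : BoundedDistribution T 𝕜)
    (h : ∀ n a, D.μ n a = D₁.μ n a + D₂.μ n a) (hT : T.IsUniform) (g : X → 𝕜)
    (hg : UniformContinuous g) (hg1 : ∀ x, ‖g x‖ ≤ 1) (n : ℕ) (a : T.Cell n) :
    (D.density hT g hg hg1).μ n a = (D₁.density hT g hg hg1).μ n a + (D₂.density hT g hg hg1).μ n a := by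
  rw [density_μ, density_μ, density_μ]
  exact integral_eq_add_of_μ_eq_add D D₁ D₂ h (uniformContinuous_cellFun hT n a hg hg1)

/-- The distribution with density `g` of levelwise-zero data is levelwise zero.
[cite: deShalit1987, I.3.4 Lemma (i), I.3.5 (11) (p. 18)] -/
theorem density_μ_eq_zero_of_μ_eq_zero (D : BoundedDistribution T 𝕜) (h : ∀ n a, D.μ n a = 0)
    (hT : T.IsUniform) (g : X → 𝕜) (hg : UniformContinuous g) (hg1 : ∀ x, ‖g x‖ ≤ 1) (n : ℕ)
    (a : T.Cell n) : (D.density hT g hg hg1).μ n a = 0 := by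
  rw [density_μ]
  exact integral_eq_zero_of_μ_eq_zero D h _

end BoundedDistribution

section RestrictUnits

variable {p : ℕ} [Fact p.Prime] {𝕜 : Type*} [NormedField 𝕜]

/-- `(·)|_{ℤ_p^×}` of a levelwise sum is the levelwise sum. [cite: deShalit1987, I.3.3 (7′), I.3.4 Lemma (i) (p. 17–18)] -/
theorem restrictUnits_μ_eq_add_of_μ_eq_add (ν ν₁ ν₂ : BoundedDistribution (ProfiniteTower.padicInt p) 𝕜)
    (h : ∀ n a, ν.μ n a = ν₁.μ n a + ν₂.μ n a) (n : ℕ) (b : ZMod (p ^ (n + 1))) :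
    (restrictUnits ν).μ n b = (restrictUnits ν₁).μ n b + (restrictUnits ν₂).μ n b := by
  rw [restrictUnits_μ, restrictUnits_μ, restrictUnits_μ]
  split_ifs
  · exact h _ _
  · rw [add_zero]

/-- `(·)|_{ℤ_p^×}` of levelwise-zero data is levelwise zero. [cite: deShalit1987, I.3.3 (7′) (p. 17–18)] -/
theorem restrictUnits_μ_eq_zero_of_μ_eq_zero (ν : BoundedDistribution (ProfiniteTower.padicInt p) 𝕜)
    (h : ∀ n a, ν.μ n a = 0) (n : ℕ) (b : ZMod (p ^ (n + 1))) : (restrictUnits ν).μ n b = 0 := by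
  rw [restrictUnits_μ]
  split_ifs
  · exact h _ _
  · rfl

end RestrictUnits

namespace GroupDistribution

variable {G : Type*} [Group G] {𝒰 : SubgroupTower G} [∀ n, (𝒰.U n).Normal] {X : Type*}
  [PseudoMetricSpace X] {T : ProfiniteTower X} {𝕜 : Type*} [NormedField 𝕜]

/-- The pull-back `comap` of a levelwise sum is the levelwise sum of the pull-backs.
[cite: deShalit1987, I.3.3 (9), I.3.4 Lemma (i) (p. 18)] -/
theorem comap_μ_eq_add_of_μ_eq_add (ν ν₁ ν₂ : BoundedDistribution T 𝕜)
    (ψ : (n : ℕ) → G ⧸ 𝒰.U n → T.Cell n) (hψ) (hinj) (hsurj)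
    (h : ∀ n a, ν.μ n a = ν₁.μ n a + ν₂.μ n a) (n : ℕ) (a : G ⧸ 𝒰.U n) :
    (comap ν ψ hψ hinj hsurj).μ n a = (comap ν₁ ψ hψ hinj hsurj).μ n a + (comap ν₂ ψ hψ hinj hsurj).μ n a := by
  rw [comap_μ, comap_μ, comap_μ]
  split_ifs
  · exact h _ _
  · rw [add_zero]

/-- The pull-back `comap` of levelwise-zero data is levelwise zero. [cite: deShalit1987, I.3.3 (9) (p. 18)] -/
theorem comap_μ_eq_zero_of_μ_eq_zero (ν : BoundedDistribution T 𝕜)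
    (ψ : (n : ℕ) → G ⧸ 𝒰.U n → T.Cell n) (hψ) (hinj) (hsurj) (h : ∀ n a, ν.μ n a = 0) (n : ℕ)
    (a : G ⧸ 𝒰.U n) : (comap ν ψ hψ hinj hsurj).μ n a = 0 := by
  rw [comap_μ]
  split_ifs
  · exact h _ _
  · rfl

end GroupDistribution

/-! ### §2. The inverse Amice transform of `P = P₁ + P₂` and of `P = 0` -/

section InvAmice

variable {p : ℕ} [Fact p.Prime]
variable {𝕜 : Type*} [NormedField 𝕜] [NormedAlgebra ℚ_[p] 𝕜] [IsUltrametricDist 𝕜] [CompleteSpace 𝕜]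

/-- `D_P = D_{P₁} + D_{P₂}` levelwise whenever `P = P₁ + P₂` (the bound proofs are irrelevant).
[cite: deShalit1987, I.3.4 Lemma (i) (p. 18)] -/
theorem invAmice₁_μ_eq_add_of_eq_add {P P₁ P₂ : PowerSeries 𝕜} {C C₁ C₂ : ℝ} (hP : P = P₁ + P₂)
    (hC : ∀ k, ‖PowerSeries.coeff k P‖ ≤ C) (hC₁ : ∀ k, ‖PowerSeries.coeff k P₁‖ ≤ C₁)
    (hC₂ : ∀ k, ‖PowerSeries.coeff k P₂‖ ≤ C₂) (n : ℕ) (a : ZMod (p ^ n)) :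
    (invAmice₁ p P hC).μ n a = (invAmice₁ p P₁ hC₁).μ n a + (invAmice₁ p P₂ hC₂).μ n a := by
  subst hP
  exact invAmice₁_add_μ hC₁ hC₂ hC n a

/-- `D_P = 0` levelwise whenever `P = 0`. [cite: deShalit1987, I.3.4 Lemma (i) (p. 18)] -/
theorem invAmice₁_μ_eq_zero_of_eq_zero {P : PowerSeries 𝕜} {C : ℝ} (hP : P = 0)
    (hC : ∀ k, ‖PowerSeries.coeff k P‖ ≤ C) (n : ℕ) (a : ZMod (p ^ n)) :
    (invAmice₁ p P hC).μ n a = 0 := by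
  subst hP
  have h0 : ∀ k, ‖PowerSeries.coeff k ((0 : PowerSeries 𝕜) + 0)‖ ≤ C := fun k ↦ by
    rw [add_zero]; exact hC k
  have h := invAmice₁_add_μ hC hC h0 n a
  simp only [invAmice₁_μ, add_zero] at h
  rw [invAmice₁_μ]
  exact left_eq_add.mp h

end InvAmice

end Literature.NumberTheory.EllipticCurves

end
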